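/- Copyright: the b2b-balaban cell (near-miss cell 7), T⁴-continuum fan-out; row NE7b ROUND-2 swarm, seat
t4-ne7b-formalise-leaf-06 (gen 6) (road W-RP, row W4 file 4a «THE EVENT HALF, THE RP HALF, THE BLOCK-COUNT TRANSPORT»;
INTENT journal l.16399).  Released under the licence of the surrounding project. -/
import Summits.QuantumFields.BalabanUV.T4Continuum.Support.HistoryChessboardEventsCutoff

/-!
# Road W-RP, row W4 file 4a: the LOSSLESS SPLIT of W4b′'s per-cutoff reading and the block-count transport

Summits-side support leaf of the T⁴-continuum cell (rung (B)+1 on a FINITE torus only; NOT infinite volume, NOT the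
mass gap, NOT the Clay statement; NOT a proof of the spine estimate NE7b).  Row NE7b, road **W-RP** (owner's rulings
R-OWNER-23-2 ∕ R-OWNER-23-8: a LIVE SECONDARY road beside the COUNT road of record), row **W4**, file 4a (generic half of
the consumer junction of sub-row W3m — `HistoryRPTowerCuts`, leaf-04 g6 — into file 3 of this lineage,
`HistoryChessboardEventsCutoff`; the tower instances are files 4b `HistoryChessboardEventsTower` (unit cells) and 4c
`HistoryChessboardEventsCubes` (cube cells)).  [folklore]
measure-theoretic bookkeeping (Mathlib) over the cell's OWN records; ONE hypothesis shape `structure EventSide … : Prop`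
(the event half of `CutoffReading`, consumed only as a binder), two DATA defs (`castZ`, `castIdx`); no `[cite:]` tag
(nothing printed is stated), no `Prop`-valued FACT minted (c1), no constant (c2∕c6), no exit ∕ socket ∕ `HistoryConstants`
file touched (c3).

WHY.  W4b′'s `CutoffReading` displays 21 clauses for ONE state on ONE carrier at ONE cutoff; W3m file 1 PRODUCES, for the
tower law `(U, Ū, …, Ū^K)` on `Tower P G K`, the clause `prob` and the five RP clauses `mP_le ∕ θ_meas ∕ θ_pres ∕ θ_invol ∕
rp` as ONE five-conjunct theorem (`cutoffRP_towerLaw(_blockAvg∕_gibbs_SU)`).  Two generic pieces of glue sit between that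
supply and file 3's END `hybridNE7_of_cutoffReadings`: (1) the split of the reading into its EVENT half and its RP half in
exactly W3m's five-conjunct shape (so the junction is one application, file 4b); (2) the top lattice of cutoff `K` has
`P.sitesPerDir K = 2·L^(m+K−K)` sites per direction — EQUAL, not definitionally equal, to the one block count `N` of the
family END — so an index transport along `N′ = N` is needed, once, inside the END.

WHAT.
* §1 `structure EventSide` (= `CutoffReading` minus `prob` and the five RP clauses: 15 clauses) and the lossless split
  **`EventSide.cutoffReading (hprob) (h5)`**, `CutoffReading.eventSide`, `CutoffReading.rp5`, `cutoffReading_iff`.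
* §2 the index transport along an equality of block counts: `castZ`, `castIdx` (`Eq`-transport, the identity re-typed;
  `val_castZ`, `castZ_natCast`, `castZ_add`, the two-sided inverse laws — the dictionary an instantiating seat needs to
  recognise its own cell events after transport), **`CutoffReading.congrN`**, `EventSide.congrN` (`subst` proofs).
* §3 **`hybridNE7_of_cutoffReadingsN`**: file 3's family END with NATIVE per-cutoff block counts `Nf K` (run A), `Nf′ K`
  (run B) and the equations `Nf K = N`, `Nf′ K = N`.

HONEST SCOPE (R-OWNER-23-8 wording for road W-RP).  Regrouping and re-typing only: NO clause of the reading is discharged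
in this file (file 4b discharges `prob`, the RP half and `Even N` for the Gibbs towers BY NAME); (EXT) (`repr`, `ev_cover`,
`bad_disj`, `bad_sub`), (LOC)∕(R-sym) for the chosen cell events (`loc`, `sym`), (U1)+(G2) (`univ_le`) stay DISPLAYED as
the fields of `EventSide`; nothing of H3 ∕ (B) ∕ BetaPertH is discharged; the count 0∕9 is unchanged.  NE7b NOT proved;
spine 0∕9.  HONEST DEPENDENCY (cell): continuum YM on T⁴ ⇐ BetaPertH ∧ nine spine estimates (0/9 proved); BetaPertH ⇐
(D1) ∧ (D4) ∧ CAP+tail; G-an2-4 gates asym, D1 and NE2/3/4.  This file changes none of it.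
-/

open Finset MeasureTheory Literature.Barriers.CriticalPhenomena.NonGibbs Literature.Probability.LatticeModels
open Literature.MathematicalPhysics.QuantumFieldTheory.Balaban1983to89
open T4IndicatorShell T4MatchingAssembly T4MatchingClosure
open Literature.MathematicalPhysics.QuantumFieldTheory.LatticeRP (IsReflectionPositiveBdd)
open Summit.QuantumFields.BalabanUV.T4Continuum HistoryChessboardAssembly HistoryChessboardEvents
open HistoryChessboardEventsCutoff

namespace Summit.QuantumFields.BalabanUV.T4Continuum.HistoryChessboardEventsSplit

noncomputable section

/-! ## §1 The event half of W4b′'s per-cutoff reading, and the lossless split -/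

section Split

variable {Ω ι Λ : Type*} [MeasurableSpace Ω] {d N : ℕ}

/-- **THE EVENT HALF OF THE PER-CUTOFF READING** (road W-RP, row W4 file 4): W4b′'s `CutoffReading` WITHOUT its clause
`prob` and WITHOUT its five RP clauses `mP_le ∕ θ_meas ∕ θ_pres ∕ θ_invol ∕ rp` — i.e. the clauses an instantiating seat of
the TOWER-LAW reading still has to read from Bałaban's expansion once W3m has produced the RP half: bookkeeping
(`Z_pos` … `ob_nonneg`), (EXT)+(DRESS) `repr`, (EXT) `ev_cover`∕`bad_disj`, (EXT)∘(LOC) `bad_sub`, (LOC) `loc` and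
(R-sym) `sym` for the CHOSEN cell events `E` (relative to the given positive algebras `mP` and reflections `θ`), (U1)+(G2)
`univ_le`, `r_nonneg`.  A hypothesis SHAPE; NOTHING of Bałaban's is asserted; no citation tag. [folklore] -/
structure EventSide (d N : ℕ) [NeZero N] (P : Finset Λ) (T : Finset ι) (A : ℝ → ι → ℝ) (Bad : Finset ι)
    (μ : Measure Ω) (Z : ℝ) (ev : ι → Set Ω) (obs : Ω → ℝ) (ob : ℝ) (E : Λ → BlockIdx d N → Set Ω)
    (θ : Fin d → ZMod N → Ω → Ω) (mP : Fin d → ZMod N → MeasurableSpace Ω) (r : ℝ) : Prop where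
  /-- the undressed partition function is positive -/
  Z_pos : 0 < Z
  /-- the bad class consists of terms -/
  bad_subset : Bad ⊆ T
  /-- term events are measurable -/
  ev_meas : ∀ τ ∈ T, MeasurableSet (ev τ)
  /-- cell events are measurable -/
  E_meas : ∀ l ∈ P, ∀ c, MeasurableSet (E l c)
  /-- the source observable is measurable … -/
  obs_meas : Measurable obs
  /-- … and bounded by `ob` -/
  obs_bdd : ∀ ω, |obs ω| ≤ ob
  /-- the bound is nonnegative -/
  ob_nonneg : 0 ≤ ob
  /-- (EXT)+(DRESS): the dressed weight of a term is the source-dressed mass of its event -/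
  repr : ∀ (t : ℝ), ∀ τ ∈ T, A t τ = Z * ∫ ω in ev τ, Real.exp (t * obs ω) ∂μ
  /-- the term events exhaust the state -/
  ev_cover : Set.univ ⊆ ⋃ τ ∈ T, ev τ
  /-- (EXT): bad events are pairwise disjoint -/
  bad_disj : (↑Bad : Set ι).PairwiseDisjoint ev
  /-- (EXT)∘(LOC): every bad event lies inside a single-cell event of some pattern -/
  bad_sub : ∀ τ ∈ Bad, ev τ ⊆ ⋃ l ∈ P, ⋃ c : BlockIdx d N, E l c
  /-- (LOC): the cell events of the positive half are positive-half measurable -/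
  loc : ∀ l ∈ P, ∀ (i : Fin d) (k : ZMod N), ∀ c ∈ halfPlus N i k, MeasurableSet[mP i k] (E l c)
  /-- (R-sym): the cell events are reflection-related -/
  sym : ∀ l ∈ P, ∀ (i : Fin d) (k : ZMod N) (c : BlockIdx d N), θ i k ⁻¹' E l c = E l (cellReflect i k c)
  /-- (U1)+(G2), ratio currency: the universally forced pattern has probability `≤ r^(N^d)` -/
  univ_le : ∀ l ∈ P, μ.real (⋂ c ∈ (Finset.univ : Finset (BlockIdx d N)), E l c) ≤ r ^ (N ^ d)
  /-- the per-cell rate is nonnegative -/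
  r_nonneg : 0 ≤ r

variable [NeZero N] {P : Finset Λ} {T : Finset ι} {A : ℝ → ι → ℝ} {Bad : Finset ι} {μ : Measure Ω} {Z : ℝ}
  {ev : ι → Set Ω} {obs : Ω → ℝ} {ob : ℝ} {E : Λ → BlockIdx d N → Set Ω} {θ : Fin d → ZMod N → Ω → Ω}
  {mP : Fin d → ZMod N → MeasurableSpace Ω} {r : ℝ}

/-- **THE JUNCTION: EVENT HALF + `prob` + THE RP HALF IN W3m's FIVE-CONJUNCT SHAPE ⇒ W4b′'s READING.**  The argument
`h5` has EXACTLY the type of the conclusion of `HistoryRPTowerCuts.cutoffRP_towerLaw(_blockAvg∕_gibbs_SU)` (leaf-04 g6,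
W3m) at `Ω := Tower P G K`, `μ := towerLaw …`, `mP := cutPos G K`, `θ := cutRefl K` — see §4. [folklore] -/
theorem EventSide.cutoffReading (H : EventSide d N P T A Bad μ Z ev obs ob E θ mP r) (hprob : IsProbabilityMeasure μ)
    (h5 : (∀ (i : Fin d) (k : ZMod N), mP i k ≤ ‹MeasurableSpace Ω›) ∧
      (∀ (i : Fin d) (k : ZMod N), Measurable (θ i k)) ∧
      (∀ (i : Fin d) (k : ZMod N), MeasurePreserving (θ i k) μ μ) ∧
      (∀ (i : Fin d) (k : ZMod N), θ i k ∘ θ i k = id) ∧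
      (∀ (i : Fin d) (k : ZMod N), IsReflectionPositiveBdd μ (mP i k) (θ i k))) :
    CutoffReading d N P T A Bad μ Z ev obs ob E θ mP r where
  prob := hprob
  Z_pos := H.Z_pos
  bad_subset := H.bad_subset
  ev_meas := H.ev_meas
  E_meas := H.E_meas
  obs_meas := H.obs_meas
  obs_bdd := H.obs_bdd
  ob_nonneg := H.ob_nonneg
  repr := H.repr
  ev_cover := H.ev_cover
  bad_disj := H.bad_disj
  bad_sub := H.bad_sub
  mP_le := h5.1
  θ_meas := h5.2.1
  θ_pres := h5.2.2.1
  θ_invol := h5.2.2.2.1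
  rp := h5.2.2.2.2
  loc := H.loc
  sym := H.sym
  univ_le := H.univ_le
  r_nonneg := H.r_nonneg

/-- Conversely, the reading's event half. [folklore] -/
theorem _root_.Summit.QuantumFields.BalabanUV.T4Continuum.HistoryChessboardEventsCutoff.CutoffReading.eventSide
    (H : CutoffReading d N P T A Bad μ Z ev obs ob E θ mP r) : EventSide d N P T A Bad μ Z ev obs ob E θ mP r where
  Z_pos := H.Z_pos
  bad_subset := H.bad_subset
  ev_meas := H.ev_meas
  E_meas := H.E_meas
  obs_meas := H.obs_meas
  obs_bdd := H.obs_bdd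
  ob_nonneg := H.ob_nonneg
  repr := H.repr
  ev_cover := H.ev_cover
  bad_disj := H.bad_disj
  bad_sub := H.bad_sub
  loc := H.loc
  sym := H.sym
  univ_le := H.univ_le
  r_nonneg := H.r_nonneg

/-- … and its RP half, in W3m's five-conjunct shape. [folklore] -/
theorem _root_.Summit.QuantumFields.BalabanUV.T4Continuum.HistoryChessboardEventsCutoff.CutoffReading.rp5
    (H : CutoffReading d N P T A Bad μ Z ev obs ob E θ mP r) :
    (∀ (i : Fin d) (k : ZMod N), mP i k ≤ ‹MeasurableSpace Ω›) ∧
      (∀ (i : Fin d) (k : ZMod N), Measurable (θ i k)) ∧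
      (∀ (i : Fin d) (k : ZMod N), MeasurePreserving (θ i k) μ μ) ∧
      (∀ (i : Fin d) (k : ZMod N), θ i k ∘ θ i k = id) ∧
      (∀ (i : Fin d) (k : ZMod N), IsReflectionPositiveBdd μ (mP i k) (θ i k)) :=
  ⟨H.mP_le, H.θ_meas, H.θ_pres, H.θ_invol, H.rp⟩

/-- **THE SPLIT IS LOSSLESS**: W4b′'s reading ⇔ event half ∧ `prob` ∧ RP half. [folklore] -/
theorem cutoffReading_iff :
    CutoffReading d N P T A Bad μ Z ev obs ob E θ mP r ↔
      EventSide d N P T A Bad μ Z ev obs ob E θ mP r ∧ IsProbabilityMeasure μ ∧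
        ((∀ (i : Fin d) (k : ZMod N), mP i k ≤ ‹MeasurableSpace Ω›) ∧
          (∀ (i : Fin d) (k : ZMod N), Measurable (θ i k)) ∧
          (∀ (i : Fin d) (k : ZMod N), MeasurePreserving (θ i k) μ μ) ∧
          (∀ (i : Fin d) (k : ZMod N), θ i k ∘ θ i k = id) ∧
          (∀ (i : Fin d) (k : ZMod N), IsReflectionPositiveBdd μ (mP i k) (θ i k))) :=
  ⟨fun H => ⟨H.eventSide, H.prob, H.rp5⟩, fun H => H.1.cutoffReading H.2.1 H.2.2⟩

end Split

/-! ## §2 Index transport along an equality of block counts -/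

section Transport

variable {d N N' : ℕ}

/-- **RESIDUE TRANSPORT** along an equality of moduli (`Eq`-transport: the identity map, re-typed; it IS Mathlib's
ring isomorphism `ZMod.ringEquivCongr h` — `castZ_eq_ringEquivCongr` — but the bare transport lets `subst` proofs see the
identity). -/
def castZ (h : N = N') : ZMod N → ZMod N' := fun k => cast (congrArg ZMod h) k

/-- **BLOCK-INDEX TRANSPORT** along an equality of block counts (coordinatewise `castZ`). -/
def castIdx (h : N = N') : BlockIdx d N → BlockIdx d N' := fun c i => castZ h (c i)

/-- `castZ rfl` is the identity (definitionally). [folklore] -/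
@[simp] theorem castZ_rfl (k : ZMod N) : castZ rfl k = k := rfl

/-- `castZ h` is Mathlib's `ZMod.ringEquivCongr h` as a function. [folklore] -/
theorem castZ_eq_ringEquivCongr (h : N = N') (k : ZMod N) : castZ h k = ZMod.ringEquivCongr h k := by
  subst h; rw [ZMod.ringEquivCongr_refl_apply]; rfl

/-- `castIdx rfl` is the identity (definitionally). [folklore] -/
@[simp] theorem castIdx_rfl (c : BlockIdx d N) : castIdx rfl c = c := rfl

/-- the transport preserves the canonical representative. [folklore] -/
@[simp] theorem val_castZ (h : N = N') (k : ZMod N) : (castZ h k).val = k.val := by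
  subst h; rfl

/-- the transport commutes with the numeral maps. [folklore] -/
@[simp] theorem castZ_natCast (h : N = N') (a : ℕ) : castZ h (a : ZMod N) = (a : ZMod N') := by
  subst h; rfl

/-- the transport is additive. [folklore] -/
@[simp] theorem castZ_add (h : N = N') (k k' : ZMod N) : castZ h (k + k') = castZ h k + castZ h k' := by
  subst h; rfl

/-- the transport is undone by the transport along the reversed equality. [folklore] -/
@[simp] theorem castZ_castZ_symm (h : N = N') (k : ZMod N') : castZ h (castZ h.symm k) = k := by
  subst h; rfl

/-- … and conversely. [folklore] -/
@[simp] theorem castZ_symm_castZ (h : N = N') (k : ZMod N) : castZ h.symm (castZ h k) = k := by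
  subst h; rfl

/-- coordinates of a transported block index. [folklore] -/
@[simp] theorem castIdx_apply (h : N = N') (c : BlockIdx d N) (i : Fin d) : castIdx h c i = castZ h (c i) := rfl

/-- the block-index transport is undone by the reversed transport. [folklore] -/
@[simp] theorem castIdx_castIdx_symm (h : N = N') (c : BlockIdx d N') : castIdx h (castIdx h.symm c) = c := by
  subst h; rfl

/-- … and conversely. [folklore] -/
@[simp] theorem castIdx_symm_castIdx (h : N = N') (c : BlockIdx d N) : castIdx h.symm (castIdx h c) = c := by
  subst h; rfl

/-- the block-index transport is a bijection. [folklore] -/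
theorem castIdx_bijective (h : N = N') : Function.Bijective (castIdx (d := d) h) := by
  subst h; exact Function.bijective_id

variable {Ω ι Λ : Type*} [MeasurableSpace Ω] [NeZero N] [NeZero N'] {P : Finset Λ} {T : Finset ι}
  {A : ℝ → ι → ℝ} {Bad : Finset ι} {μ : Measure Ω} {Z : ℝ} {ev : ι → Set Ω} {obs : Ω → ℝ} {ob : ℝ}
  {E : Λ → BlockIdx d N' → Set Ω} {θ : Fin d → ZMod N' → Ω → Ω} {mP : Fin d → ZMod N' → MeasurableSpace Ω} {r : ℝ}

/-- **W4b′'s READING TRANSPORTED ALONG AN EQUALITY OF BLOCK COUNTS** `N′ = N`: a reading over the block torus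
`BlockIdx d N′` is a reading over `BlockIdx d N` for the re-indexed cell events, reflections and positive algebras
(the case of use: `N′ := P.sitesPerDir K = 2·L^(m+K−K)`, `N := 2·L^m`). [folklore] -/
theorem _root_.Summit.QuantumFields.BalabanUV.T4Continuum.HistoryChessboardEventsCutoff.CutoffReading.congrN
    (h : N' = N) (H : CutoffReading d N' P T A Bad μ Z ev obs ob E θ mP r) :
    CutoffReading d N P T A Bad μ Z ev obs ob (fun l c => E l (castIdx h.symm c)) (fun i k => θ i (castZ h.symm k))
      (fun i k => mP i (castZ h.symm k)) r := by
  subst h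
  exact H

/-- The event half transported likewise. [folklore] -/
theorem EventSide.congrN (h : N' = N) (H : EventSide d N' P T A Bad μ Z ev obs ob E θ mP r) :
    EventSide d N P T A Bad μ Z ev obs ob (fun l c => E l (castIdx h.symm c)) (fun i k => θ i (castZ h.symm k))
      (fun i k => mP i (castZ h.symm k)) r := by
  subst h
  exact H

end Transport

/-! ## §3 File 3's family END with native per-cutoff block counts -/

section FamilyN

variable {ι Λ : Type*} [DecidableEq ι] {d N : ℕ} [NeZero N] {P : Finset Λ} {T : ℕ → Finset ι} {K₀ : ℕ}
  {Nf Nf' : ℕ → ℕ} [∀ K, NeZero (Nf K)] [∀ K, NeZero (Nf' K)]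
  {Ω : ℕ → Type*} [∀ K, MeasurableSpace (Ω K)] {A : ℕ → ℝ → ι → ℝ} {Bad : ℕ → Finset ι} {μ : ∀ K, Measure (Ω K)}
  {Z : ℕ → ℝ} {ev : ∀ K, ι → Set (Ω K)} {obs : ∀ K, Ω K → ℝ} {ob : ℝ} {E : ∀ K, Λ → BlockIdx d (Nf K) → Set (Ω K)}
  {θ : ∀ K, Fin d → ZMod (Nf K) → Ω K → Ω K} {mP : ∀ K, Fin d → ZMod (Nf K) → MeasurableSpace (Ω K)} {r : ℕ → ℝ}
  {Ω' : ℕ → Type*} [∀ K, MeasurableSpace (Ω' K)] {B shA shB Cc Rr CcRec RrRec : ℕ → ℝ → ι → ℝ}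
  {μ' : ∀ K, Measure (Ω' K)} {Z' : ℕ → ℝ} {ev' : ∀ K, ι → Set (Ω' K)} {obs' : ∀ K, Ω' K → ℝ}
  {E' : ∀ K, Λ → BlockIdx d (Nf' K) → Set (Ω' K)} {θ' : ∀ K, Fin d → ZMod (Nf' K) → Ω' K → Ω' K}
  {mP' : ∀ K, Fin d → ZMod (Nf' K) → MeasurableSpace (Ω' K)} {r' ν u s₂ c₀ rr s Wsh : ℕ → ℝ} {l₀ vol : ℝ}

/-- **THE ROAD'S END FROM TWO FAMILIES OF PER-CUTOFF READINGS WITH NATIVE BLOCK COUNTS** `Nf K`, `Nf′ K` — all EQUAL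
to one even `N` (not necessarily definitionally): file 3's `hybridNE7_of_cutoffReadings` after the transport of §2 at
every cutoff.  Nothing PRINTED is asserted; NE7b is NOT proved by this. [folklore] -/
theorem hybridNE7_of_cutoffReadingsN (hNe : Even N) (hN : ∀ K, Nf K = N) (hN' : ∀ K, Nf' K = N)
    (HA : ∀ K, K₀ ≤ K →
      CutoffReading d (Nf K) P (T K) (A K) (Bad K) (μ K) (Z K) (ev K) (obs K) ob (E K) (θ K) (mP K) (r K))
    (HB : ∀ K, K₀ ≤ K →
      CutoffReading d (Nf' K) P (T K) (B K) (Bad K) (μ' K) (Z' K) (ev' K) (obs' K) ob (E' K) (θ' K) (mP' K) (r' K))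
    (hr : Summable r) (hr' : Summable r')
    (hSh : ShellWeightBound l₀ T A B shA shB Wsh)
    (hTB : ReindexedBudget l₀ vol T (fun K t τ => A K t τ - shA K t τ) (fun K t τ => B K t τ - shB K t τ)
      (fun K _ => Bad K) Cc Rr CcRec RrRec ν u s₂ c₀ rr s)
    (hrr : Summable rr) (hu : Summable u) (hs : Summable s) (hs₂ : Summable s₂) :
    ∃ K₁ K₂, K₀ ≤ K₁ ∧ HybridNE7 l₀ vol (fun K => T (K₁ + (K₂ + K))) (fun K => A (K₁ + (K₂ + K)))
      (fun K => B (K₁ + (K₂ + K))) (fun K _ => Bad (K₁ + (K₂ + K)))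
      (fun K => Real.exp (2 * (ob * l₀)) * ((#P : ℝ) * (N : ℝ) ^ d * (r (K₁ + (K₂ + K)) + r' (K₁ + (K₂ + K)))))
      (fun K => shA (K₁ + (K₂ + K))) (fun K => shB (K₁ + (K₂ + K))) (fun K => Wsh (K₁ + (K₂ + K)))
      (fun K => (rr (K₁ + (K₂ + K)) + u (K₁ + (K₂ + K))) + (s (K₁ + (K₂ + K)) + s₂ (K₁ + (K₂ + K)))) :=
  hybridNE7_of_cutoffReadings hNe (fun K hK => (HA K hK).congrN (hN K)) (fun K hK => (HB K hK).congrN (hN' K))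
    hr hr' hSh hTB hrr hu hs hs₂

end FamilyN

/-! ## §4 Sanity -/

namespace Sanity

/-- NON-VACUITY of the event half (carrier `Unit`, Dirac state, one term with event `univ`, empty bad class, all cell
events `univ`, identity reflections, `mP = ⊥`), and the junction §1 at work: with `prob` and a (trivial) RP five-tuple it
IS file 3's reading. -/
example : CutoffReading 1 2 ({()} : Finset Unit) ({()} : Finset Unit) (fun _ _ => (1 : ℝ)) (∅ : Finset Unit)
    (Measure.dirac ()) 1 (fun _ => Set.univ) (fun _ => 0) 0 (fun _ _ => Set.univ) (fun _ _ => id) (fun _ _ => ⊥) 1 := by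
  have H : EventSide 1 2 ({()} : Finset Unit) ({()} : Finset Unit) (fun _ _ => (1 : ℝ)) (∅ : Finset Unit)
      (Measure.dirac ()) 1 (fun _ => Set.univ) (fun _ => 0) 0 (fun _ _ => Set.univ) (fun _ _ => id) (fun _ _ => ⊥) 1 :=
    { Z_pos := one_pos
      bad_subset := Finset.empty_subset _
      ev_meas := fun _ _ => MeasurableSet.univ
      E_meas := fun _ _ _ => MeasurableSet.univ
      obs_meas := measurable_const
      obs_bdd := fun _ => by simp
      ob_nonneg := le_rfl
      repr := fun t τ _ => by simp [Measure.restrict_univ]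
      ev_cover := fun ω _ => Set.mem_iUnion₂.2 ⟨(), Finset.mem_singleton_self _, Set.mem_univ ω⟩
      bad_disj := by simp
      bad_sub := by simp
      loc := fun _ _ _ _ _ _ => by simp
      sym := fun _ _ _ _ _ => by simp
      univ_le := fun _ _ => (measureReal_mono (Set.subset_univ _) (measure_ne_top _ _)).trans_eq (by simp)
      r_nonneg := zero_le_one }
  exact H.cutoffReading Measure.dirac.isProbabilityMeasure
    ⟨fun _ _ => bot_le, fun _ _ => measurable_id, fun _ _ => MeasurePreserving.id _, fun _ _ => rfl,
      fun _ _ g _ _ => integral_nonneg fun ω => mul_self_nonneg (g ω)⟩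

end Sanity

end

end Summit.QuantumFields.BalabanUV.T4Continuum.HistoryChessboardEventsSplit
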